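import Summits.RiemannHypothesis.RiemannHypothesis.Theorems.PfPersistenceF1SupersetRigidity
import HarnessLib

/-!
# F1 (Beurling fakes) — Gaussian-window Chebyshev core of THEOREM F1-SG (i) / F1-SG⁺ (i′)

KERNEL SUPPLEMENT to `PfPersistenceF1SupersetRigidity` (704e13ea2e62), FAKES §1.17.2 / RIDER 2.
Mechanism/rigidity campaign; no RH claims.

The informal step (i) of THEOREM F1-SG reads: since the Gaussian window `exp (-(δ²u²)/2)` is at least
`exp (-1/2)` on `0 ≤ u ≤ 1/δ`, the windowed mass of a measure at scale `δ = 1/U` dominates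
`exp (-1/2)` times its mass on `[0, U]`; hence a bound on the windowed mass at every scale gives a
LINEAR-in-`U` bound on the mass of `[0, U]`.  This file proves exactly that measure-theoretic core,
for an arbitrary measure `ρ` on `ℝ` (no g-prime system, no explicit formula, no ζ — as in the
A415 (1) P1 reading of the parent file).

PROVED-Lean here: `gaussWindow_ge_of_mem_Icc`, `measure_Icc_mul_le_windowMass`,
`measure_Icc_le_of_windowMass_le`.  Nothing else is claimed.
-/

set_option linter.dupNamespace false

open MeasureTheory Set
open scoped ENNReal

namespace Summit.RiemannHypothesis.RiemannHypothesis.Theorems.PfPersistence.Fake1.SupersetRigidity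

/-- On `0 ≤ u ≤ 1/δ` (with `0 < δ`) the Gaussian window is at least `exp (-1/2)`. -/
theorem gaussWindow_ge_of_mem_Icc {δ u : ℝ} (hδ : 0 < δ) (hu : u ∈ Icc (0 : ℝ) (1 / δ)) :
    ENNReal.ofReal (Real.exp (-(1 : ℝ) / 2)) ≤ gaussWindow δ u := by
  unfold gaussWindow
  apply ENNReal.ofReal_le_ofReal
  apply Real.exp_le_exp.mpr
  have h0 : 0 ≤ u := hu.1
  have h1 : u ≤ 1 / δ := hu.2
  have hδu : δ * u ≤ 1 := by
    calc δ * u ≤ δ * (1 / δ) := by exact mul_le_mul_of_nonneg_left h1 hδ.le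
      _ = 1 := by field_simp
  have hδu0 : 0 ≤ δ * u := mul_nonneg hδ.le h0
  have hsq : δ ^ 2 * u ^ 2 ≤ 1 := by
    have : (δ * u) ^ 2 ≤ 1 ^ 2 := by
      exact pow_le_pow_left₀ hδu0 hδu 2
    simpa [mul_pow] using this
  linarith

/-- CHEBYSHEV CORE of F1-SG (i): `exp (-1/2) · ρ [0, 1/δ] ≤ windowMass ρ δ` for every measure `ρ`
on `ℝ` and every scale `δ > 0`. -/
theorem measure_Icc_mul_le_windowMass (ρ : Measure ℝ) {δ : ℝ} (hδ : 0 < δ) :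
    ENNReal.ofReal (Real.exp (-(1 : ℝ) / 2)) * ρ (Icc (0 : ℝ) (1 / δ)) ≤ windowMass ρ δ := by
  unfold windowMass
  calc ENNReal.ofReal (Real.exp (-(1 : ℝ) / 2)) * ρ (Icc (0 : ℝ) (1 / δ))
      = ∫⁻ _ in Icc (0 : ℝ) (1 / δ), ENNReal.ofReal (Real.exp (-(1 : ℝ) / 2)) ∂ρ := by
        rw [setLIntegral_const]
    _ ≤ ∫⁻ u in Icc (0 : ℝ) (1 / δ), gaussWindow δ u ∂ρ := by
        apply setLIntegral_mono' measurableSet_Icc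
        intro u hu
        exact gaussWindow_ge_of_mem_Icc hδ hu
    _ ≤ ∫⁻ u, gaussWindow δ u ∂ρ := setLIntegral_le_lintegral _ _

/-- LINEAR MASS BOUND FROM WINDOW DOMINATION (the shape used in F1-SG (i) with `δ = 1/U`):
if the windowed mass at scale `1/U` is at most `M`, then `ρ [0, U] ≤ exp (1/2) · M`. -/
theorem measure_Icc_le_of_windowMass_le (ρ : Measure ℝ) {U : ℝ} (hU : 0 < U) {M : ℝ≥0∞}
    (h : windowMass ρ (1 / U) ≤ M) :
    ρ (Icc (0 : ℝ) U) ≤ ENNReal.ofReal (Real.exp ((1 : ℝ) / 2)) * M := by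
  have hδ : 0 < 1 / U := by positivity
  have h1 : ENNReal.ofReal (Real.exp (-(1 : ℝ) / 2)) * ρ (Icc (0 : ℝ) U) ≤ M := by
    have := measure_Icc_mul_le_windowMass ρ hδ
    rw [one_div_one_div] at this
    exact this.trans h
  have hprod : ENNReal.ofReal (Real.exp ((1 : ℝ) / 2)) * ENNReal.ofReal (Real.exp (-(1 : ℝ) / 2)) = 1 := by
    rw [← ENNReal.ofReal_mul (Real.exp_pos _).le, ← Real.exp_add]
    norm_num
  calc ρ (Icc (0 : ℝ) U)
      = ENNReal.ofReal (Real.exp ((1 : ℝ) / 2)) *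
          (ENNReal.ofReal (Real.exp (-(1 : ℝ) / 2)) * ρ (Icc (0 : ℝ) U)) := by
        rw [← mul_assoc, hprod, one_mul]
    _ ≤ ENNReal.ofReal (Real.exp ((1 : ℝ) / 2)) * M := by
        gcongr

end Summit.RiemannHypothesis.RiemannHypothesis.Theorems.PfPersistence.Fake1.SupersetRigidity
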